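import Literature.NumberTheory.GaloisRepresentations.ArtinConductorLocalLAdicProofs
import Literature.NumberTheory.GaloisRepresentations.ArtinConductorLocalModularProofs
import Literature.NumberTheory.GaloisRepresentations.ArtinConductorWeilDeligneProofs
import Literature.NumberTheory.GaloisRepresentations.HasseArfProofs
import HarnessLib

/-!
# Artin's theorem and the integrality of the Artin conductor: the discharges from Hasse–Arf
(companion to `ArtinRepresentation.lean`, `ArtinConductorIntegrality.lean`, `ArtinConductor.lean`)

Theorems only.  The tree reduces every faithful form of Artin's integrality theorem
`f(χ) ∈ ℕ` (Serre, *Local Fields*, VI §2 Thm 1') and of Katz's Prop. 1.9 / Remark 1.10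
(integrality of the Artin conductor `codim M^{I} + Swan`) to the single input **Hasse–Arf**
(`Literature.NumberTheory.GaloisRepresentations.hasseArf`, Serre IV §3), through Brauer's
induction theorem, the integrality of the different exponent, Herbrand's theorem and, for
`ℓ`-adic coefficients, Katz 1.8 (finite wild image); the endpoints are the `…_of_hasseArf`
theorems of `ArtinRepresentationModularProofs`, `ArtinConductorExponentHasseArfProofs`,
`ArtinConductorLocalLAdicProofs`, `ArtinConductorLocalModularProofs` and
`ArtinConductorWeilDeligneProofs`, each quantified over the Hasse–Arf statement for the finite
Galois extensions of Dedekind fraction fields in one universe.  The Hasse–Arf theorem is now the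
universe-polymorphic theorem `hasseArf_holds` (`HasseArfProofs`, completion-free along Serre IV §3
and V §§3–7), so each endpoint closes its named fact:

* `Literature.NumberTheory.GaloisRepresentations.exists_natCast_eq_artinExponent_finiteField_holds`
  (`ArtinRepresentation.lean`; Katz 1.9 for `A = 𝔽_λ`, Serre *LinRep* §19.3);
* `Literature.NumberTheory.GaloisRepresentations.exists_natCast_eq_artinExponent_holds`
  (`ArtinConductorIntegrality.lean`; Serre VI §2 Thm 1' for the inertia group, all coefficient
  characteristics `≠ p`);
* `Literature.NumberTheory.GaloisRepresentations.GaloisRep.exists_natCast_eq_artinConductorAt_of_hasOpenInertiaKerAt_holds`,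
  `Literature.NumberTheory.GaloisRepresentations.GaloisRep.natCast_artinConductorExponent_of_hasOpenInertiaKerAt_holds`
  (`ArtinConductor.lean`; Katz 1.9 as printed, at a prime of a number field);
* `Literature.NumberTheory.GaloisRepresentations.GaloisRep.natCast_artinConductorExponent_lAdic_holds`
  (`ArtinConductor.lean`; Katz 1.9 with Remark 1.10 at a prime of a number field);
* `Literature.NumberTheory.GaloisRepresentations.GaloisRep.natCast_localArtinConductor_of_hasOpenInertiaKerAt_holds`,
  `Literature.NumberTheory.GaloisRepresentations.GaloisRep.natCast_localArtinConductor_lAdic_holds`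
  (`ArtinConductor.lean`; Katz 1.9, resp. 1.9 with 1.10, over a non-archimedean local field of
  any characteristic);
* `Literature.NumberTheory.GaloisRepresentations.WeilDeligneRep.natCast_floor_artinConductor_holds`
  (`ArtinConductor.lean`; Serre VI §2 Thm 1' for the Weil-group representation underlying a
  Weil–Deligne representation).

The `λ`-adic integrality at a prime of a number field
(`GaloisRep.exists_natCast_eq_artinConductorAt_lAdic_holds`) is in
`ArtinConductorIntegralityLAdicProofs`.

## References

* N. M. Katz, *Gauss Sums, Kloosterman Sums, and Monodromy Groups*, Annals of Math. Studies 116,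
  Princeton 1988, Ch. 1: 1.8, Prop. 1.9 and its proof, Remark 1.10. [Katz1988]
* J.-P. Serre, *Local Fields*, GTM 67 (1979), Ch. IV §3 (Herbrand, Hasse–Arf); Ch. VI §2 Thm 1'
  and its proof, Cor. 1'; §3. [SerreLocalFields1979]
* J.-P. Serre, *Linear Representations of Finite Groups*, GTM 42 (1977), §18.4 Thm 43, §19.3.
  [SerreLinearRepresentations1977]
-/

noncomputable section

open scoped NumberField Valued
open ValuativeRel
open Literature.NumberTheory.GaloisRepresentations.IsNonarchimedeanLocalField

namespace Literature.NumberTheory.GaloisRepresentations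

universe u v w

/-! ### Artin's theorem for the inertia group at a prime of a number field -/

section NumberField

variable {K : Type u} [Field K] {A : Type v} [Field A] {M : Type w} [AddCommGroup M] [Module A M]

/-- **Artin's theorem over a finite coefficient field, discharged** (the named fact
`exists_natCast_eq_artinExponent_finiteField` of `ArtinRepresentation.lean`): for a number field
`K`, `𝔓 ∣ v`, a finite normal layer `E/K` of `K̄` and a finite-dimensional representation `τ` of
the inertia group `I(𝔓 ∩ E)` over a finite field `A` with `(q_v : A) ≠ 0`, Serre's exponent
`f(τ)` is a natural number.  Proof: `exists_natCast_eq_artinExponent_finiteField_of_hasseArf`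
(Brauer characters, the different, Herbrand; `ArtinRepresentationModularProofs`) applied to
`hasseArf_holds`.
[cite: Katz1988, Ch. 1, Prop. 1.9 (and its proof)]
[cite: SerreLinearRepresentations1977, §19.3 (iii) and Thm 44]
[cite: SerreLocalFields1979, Ch. IV §3, Theorem (Hasse–Arf)] -/
theorem exists_natCast_eq_artinExponent_finiteField_holds :
    exists_natCast_eq_artinExponent_finiteField (K := K) (A := A) (M := M) :=
  exists_natCast_eq_artinExponent_finiteField_of_hasseArf fun _ _ _ _ _ _ _ _ _ _ => hasseArf_holds

/-- **Artin's integrality theorem for the inertia group, discharged** (the named fact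
`exists_natCast_eq_artinExponent` of `ArtinConductorIntegrality.lean`; Serre, *Local Fields*,
VI §2 Thm 1' with Cor. 1'): for a number field `K`, `𝔓 ∣ v`, a finite normal layer `E/K` of `K̄`
and a finite-dimensional representation `τ` of `I(𝔓 ∩ E)` over a field `A` with `(q_v : A) ≠ 0`,
`f(τ) = Σ_{i ≥ 0} (g_i/g_0) codim M^{G_i} ∈ ℕ`.  Proof: `exists_natCast_eq_artinExponent_of_hasseArf'`
(Brauer's induction theorem, the different, Herbrand, the finite-field case;
`ArtinRepresentationModularProofs`) applied to `hasseArf_holds`.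
[cite: SerreLocalFields1979, Ch. VI §2, Thm 1' and Cor. 1' to Prop. 2]
[cite: Katz1988, Ch. 1, Prop. 1.9 (proof)]
[cite: SerreLocalFields1979, Ch. IV §3, Theorem (Hasse–Arf)] -/
theorem exists_natCast_eq_artinExponent_holds :
    exists_natCast_eq_artinExponent (K := K) (A := A) (M := M) :=
  exists_natCast_eq_artinExponent_of_hasseArf' fun _ _ _ _ _ _ _ _ _ _ => hasseArf_holds

end NumberField

namespace GaloisRep

/-! ### Katz 1.9 / 1.10 at a prime of a number field -/

section FiniteQuotient

variable {K : Type u} [Field K] {A : Type v} [Field A] [TopologicalSpace A]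
  {M : Type w} [AddCommGroup M] [Module A M] [TopologicalSpace M]

/-- **The corrected Artin–Katz integrality statement, discharged** (the named fact
`GaloisRep.exists_natCast_eq_artinConductorAt_of_hasOpenInertiaKerAt` of `ArtinConductor.lean`;
Katz, Prop. 1.9 as printed): for a number field `K`, `𝔓 ∣ v`, a finite-dimensional
`ρ : Γ_K → GL(M)` over a field `A` with `(q_v : A) ≠ 0` whose restriction to `I_𝔓` factors through
a finite discrete quotient, `a_𝔓(ρ) ∈ ℕ`.  Proof:
`exists_natCast_eq_artinConductorAt_of_hasOpenInertiaKerAt_of_hasseArf'`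
(`ArtinRepresentationModularProofs`) applied to `hasseArf_holds`.
[cite: Katz1988, Ch. 1, Prop. 1.9 (and its proof)]
[cite: SerreLocalFields1979, Ch. VI §2, Thm 1' and Cor. 1']
[cite: SerreLocalFields1979, Ch. IV §3, Theorem (Hasse–Arf)] -/
theorem exists_natCast_eq_artinConductorAt_of_hasOpenInertiaKerAt_holds :
    GaloisRep.exists_natCast_eq_artinConductorAt_of_hasOpenInertiaKerAt.{u, v, w}
      (K := K) (A := A) (M := M) :=
  exists_natCast_eq_artinConductorAt_of_hasOpenInertiaKerAt_of_hasseArf'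
    fun _ _ _ _ _ _ _ _ _ _ => hasseArf_holds

end FiniteQuotient

section NumberFieldExponent

variable {K : Type u} [Field K] [NumberField K]

/-- **Katz's Prop. 1.9 (finite-quotient form) for the conductor exponent at a prime of a number
field, discharged** (the named fact `GaloisRep.natCast_artinConductorExponent_of_hasOpenInertiaKerAt`
of `ArtinConductor.lean`): `(a_v(ρ) : ℝ) = a_𝔓(ρ)` for every `𝔓 ∣ v`, every field `A` with
`(q_v : A) ≠ 0` and every finite-dimensional `ρ` with `HasOpenInertiaKerAt`.  Proof:
`natCast_artinConductorExponent_of_hasOpenInertiaKerAt_of_hasseArf'`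
(`ArtinRepresentationModularProofs`) applied to `hasseArf_holds`.
[cite: Katz1988, Ch. 1, Prop. 1.9 (and its proof)]
[cite: SerreLocalFields1979, Ch. VI §2 Thm 1', §3, and Ch. IV §3, Theorem (Hasse–Arf)] -/
theorem natCast_artinConductorExponent_of_hasOpenInertiaKerAt_holds :
    natCast_artinConductorExponent_of_hasOpenInertiaKerAt.{u, v, w} (K := K) :=
  natCast_artinConductorExponent_of_hasOpenInertiaKerAt_of_hasseArf'
    fun _ _ _ _ _ _ _ _ _ _ => hasseArf_holds

/-- **Katz's Prop. 1.9 with Remark 1.10 for the conductor exponent at a prime of a number field,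
discharged** (the named fact `GaloisRep.natCast_artinConductorExponent_lAdic` of
`ArtinConductor.lean`): for `ρ : Γ_K → GL(M)` continuous on a finite-dimensional vector space over
a finite extension of `ℚ_ℓ` with its module topology, `v ∤ ℓ` and `𝔓 ∣ v`,
`(a_v(ρ) : ℝ) = a_𝔓(ρ)`.  Proof: `natCast_artinConductorExponent_lAdic_of_hasseArf`
(`ArtinConductorExponentHasseArfProofs`) applied to `hasseArf_holds`.
[cite: Katz1988, Ch. 1, Prop. 1.9 and Remark 1.10]
[cite: SerreLocalFields1979, Ch. VI §3 and Ch. IV §3, Theorem (Hasse–Arf)] -/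
theorem natCast_artinConductorExponent_lAdic_holds :
    natCast_artinConductorExponent_lAdic.{u, v, w} (K := K) :=
  natCast_artinConductorExponent_lAdic_of_hasseArf fun _ _ _ _ _ _ _ _ _ _ => hasseArf_holds

end NumberFieldExponent

/-! ### Katz 1.9 / 1.10 over a non-archimedean local field -/

section Local

variable {F : Type u} [Field F] [ValuativeRel F] [TopologicalSpace F] [IsNonarchimedeanLocalField F]

/-- **Katz's Prop. 1.9 with Remark 1.10 over a non-archimedean local field of any characteristic,
discharged** (the named fact `GaloisRep.natCast_localArtinConductor_lAdic` of
`ArtinConductor.lean`): for `ℓ ≠ p`, `E_λ/ℚ_ℓ` finite and `ρ : Γ_F → GL(M)` continuous on a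
finite-dimensional `E_λ`-space with its module topology,
`(localArtinConductor ρ : ℝ) = codim M^{I_F} + sw(ρ)`.  Proof:
`natCast_localArtinConductor_lAdic_of_hasseArf` (`ArtinConductorLocalLAdicProofs`) applied to
`hasseArf_holds`.
[cite: Katz1988, Ch. 1, Prop. 1.9 and Remark 1.10]
[cite: SerreLocalFields1979, Ch. IV §3, Theorem (Hasse–Arf)] -/
theorem natCast_localArtinConductor_lAdic_holds :
    natCast_localArtinConductor_lAdic.{u, v, w} (F := F) :=
  natCast_localArtinConductor_lAdic_of_hasseArf fun _ _ _ _ _ _ _ _ _ _ => hasseArf_holds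

/-- **Katz's Prop. 1.9 (finite-quotient form) over a non-archimedean local field of any
characteristic, discharged** (the named fact `GaloisRep.natCast_localArtinConductor_of_hasOpenInertiaKerAt`
of `ArtinConductor.lean`): for every field `A` with `(q_F : A) ≠ 0` and every finite-dimensional
`ρ : Γ_F → GL(M)` whose restriction to `I_F` factors through a finite discrete quotient,
`(localArtinConductor ρ : ℝ) = codim M^{I_F} + sw(ρ)`.  Proof:
`natCast_localArtinConductor_of_hasOpenInertiaKerAt_of_hasseArf'`
(`ArtinConductorLocalModularProofs`) applied to `hasseArf_holds`.
[cite: Katz1988, Ch. 1, Prop. 1.9 (and its proof)]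
[cite: SerreLocalFields1979, Ch. IV §3, Theorem (Hasse–Arf)] -/
theorem natCast_localArtinConductor_of_hasOpenInertiaKerAt_holds :
    natCast_localArtinConductor_of_hasOpenInertiaKerAt.{u, v, w} (F := F) :=
  natCast_localArtinConductor_of_hasOpenInertiaKerAt_of_hasseArf'
    fun _ _ _ _ _ _ _ _ _ _ => hasseArf_holds

end Local

end GaloisRep

/-! ### Weil–Deligne representations -/

namespace WeilDeligneRep

variable {F : Type u} [Field F] [ValuativeRel F] [TopologicalSpace F] [IsNonarchimedeanLocalField F]
  {C : Type v} [Field C] [CharZero C] {V : Type w} [AddCommGroup V] [Module C V]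

/-- **Integrality of the Artin conductor of the Weil-group representation underlying a
Weil–Deligne representation, discharged** (the named fact
`WeilDeligneRep.natCast_floor_artinConductor` of `ArtinConductor.lean`; Serre VI §2 Thm 1'
transported to the Weil group): for a non-archimedean local field `F` of any characteristic and a
finite-dimensional Weil–Deligne representation `r = (ρ, N)` over a field of characteristic `0`,
`⌊a(ρ)⌋₊ = a(ρ)`.  Proof: `natCast_floor_artinConductor_of_hasseArf`
(`ArtinConductorWeilDeligneProofs`) applied to `hasseArf_holds`.
[cite: SerreLocalFields1979, Ch. VI §2, Thm 1']
[cite: SerreLocalFields1979, Ch. IV §3, Theorem (Hasse–Arf)] -/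
theorem natCast_floor_artinConductor_holds :
    natCast_floor_artinConductor (F := F) (C := C) (V := V) :=
  natCast_floor_artinConductor_of_hasseArf fun _ _ _ _ _ _ _ _ _ _ => hasseArf_holds

end WeilDeligneRep

end Literature.NumberTheory.GaloisRepresentations

end
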